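import Summits.QuantumFields.BalabanUV.Beta.FP.PerfectRemainderSliceLocal

/-!
# `BalabanUV.Beta.FP.PerfectRemainderSliceLocalLetters` — road «FP» for binder row D1, leaf H2-P, row H2-P-KER-ASM v1: sequel of `FP/PerfectRemainderSliceLocal`
# (split by the 400-line rule) — periodic endpoint values of the order-3 chain at `Re W_∞`, measurability of the top slice, and the UNCONDITIONAL graded letters

HONEST DEPENDENCY (page 1, mandatory): continuum YM on T⁴ ⇐ BetaPertH ∧ nine spine estimates (0/9 proved); BetaPertH ⇐ (D1) ∧ (D4) ∧ CAP+tail;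
G-an2-4 gates asym, D1 and NE2/3/4.  HONEST FRAMING (cell contract, verbatim): «discharging `BetaPertH` makes Bałaban's UV stability UNCONDITIONAL —
a real constructive-QFT result; it is NOT the continuum limit and NOT the Clay problem.»  THIS MODULE DISCHARGES NOTHING of the wall: [our object] instantiation BY
NAME of `FP/RemainderSymbolChain.norm_bSl_le` (p235361) at the curves of `FP/RemainderSymbolSlice` (p235721) with H2-P-REG R2's LOCAL letters
(`PerfectSymbolDeriv.graded_perfect_feyn_entry` ∕ `graded_perfect_excess_entry`, p236916) and `PerfectPropagatorRemainderSymbol.hinv_wInf` (p236670); [folklore]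
calculus for the endpoint values.  One explicit real constant `Krem` ([our object]); no `def … : Prop`; nothing cited; 0 sorry; 0 wall binders; NOT D1, NOT BetaPertH,
NOT continuum, NOT Clay.

ABSOLUTE RULE (cell charter, verbatim): «No internally-minted statement may enter as a cited fact. Every hypothesis is either kernel-proved in this package or a
verbatim quotation of a PUBLISHED theorem with page reference. The manuscript(s) under audit are NOT citable for their own disputed steps — they are the thing
under adjudication; programme-internal (2001/route/tribunal) claims are never citable.»

WHAT (notation of `FP/PerfectRemainderSliceLocal`: base point `s`, direction `i`, `q := removeNth i s ∈ BZ d ∖ {0}`, `U`, `V`):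
* §4 [our object] PERIODIC ENDPOINT VALUES: `remSl_k (t + 2π) = remSl_k t` on `V` for `k ≤ 3` (order 0 from the periodic matrix slices by one unfolding; orders 1–3
  because derivatives of eventually-equal functions agree — `periodic_of_deriv`, no unfolding of `bSl_k`), whence **`remSl_wInf_endpoints`**: `remSl_k (−π) = remSl_k π`.
* §5 [folklore] **`aestronglyMeasurable_remSl3_wInf`** — the top slice is a.e.-strongly measurable on `[−π,π]` (`measurable_deriv` of `remSl2` + the link).
* §6 [our object] **`norm_remSl_wInf_le_local`** — for `t ∈ [−π,π]`, `p := update s i t`: `‖remSl_k wInf s i α β t‖ ≤ 3ᵏ·Krem d∕‖p‖ᵏ` (k ≤ 3),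
  `Krem d := (d+1)·aSum((d+1)(π²∕4)^{d+4}, (d+1)KAP d, (d+1)KAP d, (d+1)KAP d, π+1)·KRP d · cSum(4∕π², 2, 2, 2, π+1)` — the proof of
  `RemainderSymbolSlice.norm_remSl_le` with R2's local rows in place of R1's global ones; every hypothesis is a slice position.
Consumed by `FP/PerfectPropagatorKernel` (H2-P-KER-ASM v1) through `FP/PuncturedCoordDerivMajorant`.
Provenance: G-an2-4 swarm leaf prover 05, gen 35 (prover-b2b-balaban-gan24-formalise-leaf-05-g35-0), cross-lane on road FP (INTENT CLAIMS l.21819, owner GO l.21970), 2026-08-20.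
-/

noncomputable section

namespace Summit.QuantumFields.BalabanUV.Beta.FP.PerfectRemainderSliceLocal

open Matrix Filter Finset Set MeasureTheory
open scoped Matrix.Norms.Operator BigOperators Topology
open Literature.MathematicalPhysics.QuantumFieldTheory.Balaban1983to89
open B4Strip (ofRealVec)
open B4ContourShift (BZ ofRealVec_insertNth)
open B5Prop11Fiber (d1Sym)
open Summit.QuantumFields.BalabanUV.Beta.FP.PerfectSymbol166 (W166Inf)
open Summit.QuantumFields.BalabanUV.Beta.FP.PerfectSymbol166StripReg (delta166 delta166_pos)
open Summit.QuantumFields.BalabanUV.Beta.FP.PerfectPropagatorSymbol (feynMat maxwellMat)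
open Summit.QuantumFields.BalabanUV.Beta.FP.DispersionSliceChain (fD fD1 fD2 fD3 fD_pos norm_sq_le_fD abs_fD1_le abs_fD2_le abs_fD3_le)
open Summit.QuantumFields.BalabanUV.Beta.FP.RemainderSymbolChain (bSl0 uSl0 zSl0 aSum cSum norm_bSl_le)
open Summit.QuantumFields.BalabanUV.Beta.FP.SliceReciprocalChain (rc0)
open Summit.QuantumFields.BalabanUV.Beta.FP.RemainderSymbolSlice (feynSl excSl remSl0 remSl1 remSl2 remSl3 feynSl_zero excSl_zero feynSl_update excSl_update
  update_eq_insertNth slicePt_facts)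
open Summit.QuantumFields.BalabanUV.Beta.FP.PerfectPropagatorRemainderSymbol (wInf hinv_wInf)
open Summit.QuantumFields.BalabanUV.Beta.FP.PerfectSymbolDeriv (KAP KRP graded_perfect_feyn_entry graded_perfect_excess_entry)
open Summit.QuantumFields.BalabanUV.Beta.GAN24.InverseRate (norm_le_card_mul)

variable {d : ℕ}

/-! ## §4 `2π`-periodic endpoint values of `remSl0 … remSl3` -/

section Endpoints

variable {s : Fin (d + 1) → ℝ} {i : Fin (d + 1)} (hq : i.removeNth s ∈ BZ d) (hq0 : i.removeNth s ≠ 0)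

include hq in
/-- [our object] order 0: `remSl0 (t + 2π) = remSl0 t` on the left side interval (one unfolding to the periodic letters of §2). -/
theorem remSl0_wInf_add_two_pi (α β : Fin (d + 1)) {t : ℝ}
    (ht : t ∈ Ioo (-Real.pi - delta166 (d + 1)) (-Real.pi + delta166 (d + 1))) :
    remSl0 (wInf (d := d)) s i α β (t + 2 * Real.pi) = remSl0 (wInf (d := d)) s i α β t := by
  simp only [remSl0, bSl0, uSl0, zSl0, rc0, feynSl_zero, excSl_zero, feyn_slice_add_two_pi hq ht, excess_slice_add_two_pi hq ht,
    fD_add_two_pi]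

/-- [folklore] PERIODICITY PASSES TO THE DERIVATIVE: if `g (t + 2π) = g t` on the open `V`, and `g′ = g₁` holds at the points of `V` and of `V + 2π`, then
`g₁ (t + 2π) = g₁ t` on `V`. -/
theorem periodic_of_deriv {g g₁ : ℝ → ℂ} {a b : ℝ}
    (hper : ∀ t ∈ Ioo a b, g (t + 2 * Real.pi) = g t)
    (hV : ∀ t ∈ Ioo a b, HasDerivAt g (g₁ t) t) (hV' : ∀ t ∈ Ioo a b, HasDerivAt g (g₁ (t + 2 * Real.pi)) (t + 2 * Real.pi)) :
    ∀ t ∈ Ioo a b, g₁ (t + 2 * Real.pi) = g₁ t := by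
  intro t ht
  have hev : (fun u => g (u + 2 * Real.pi)) =ᶠ[𝓝 t] g :=
    Filter.eventuallyEq_of_mem (isOpen_Ioo.mem_nhds ht) fun u hu => hper u hu
  rw [← (hV t ht).deriv, ← hev.deriv_eq, deriv_comp_add_const, (hV' t ht).deriv]

include hq hq0 in
/-- [our object] **`remSl_k (t + 2π) = remSl_k t` ON THE LEFT SIDE INTERVAL, `k ≤ 3`** — order 0 from §2, then thrice `periodic_of_deriv` along the links of §3
(no unfolding of `bSl_k`). -/
theorem remSl_wInf_add_two_pi (α β : Fin (d + 1)) :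
    (∀ t ∈ Ioo (-Real.pi - delta166 (d + 1)) (-Real.pi + delta166 (d + 1)),
        remSl0 (wInf (d := d)) s i α β (t + 2 * Real.pi) = remSl0 (wInf (d := d)) s i α β t) ∧
      (∀ t ∈ Ioo (-Real.pi - delta166 (d + 1)) (-Real.pi + delta166 (d + 1)),
        remSl1 (wInf (d := d)) s i α β (t + 2 * Real.pi) = remSl1 (wInf (d := d)) s i α β t) ∧
      (∀ t ∈ Ioo (-Real.pi - delta166 (d + 1)) (-Real.pi + delta166 (d + 1)),
        remSl2 (wInf (d := d)) s i α β (t + 2 * Real.pi) = remSl2 (wInf (d := d)) s i α β t) ∧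
      (∀ t ∈ Ioo (-Real.pi - delta166 (d + 1)) (-Real.pi + delta166 (d + 1)),
        remSl3 (wInf (d := d)) s i α β (t + 2 * Real.pi) = remSl3 (wInf (d := d)) s i α β t) := by
  have h0 : ∀ t ∈ Ioo (-Real.pi - delta166 (d + 1)) (-Real.pi + delta166 (d + 1)),
      remSl0 (wInf (d := d)) s i α β (t + 2 * Real.pi) = remSl0 (wInf (d := d)) s i α β t :=
    fun t ht => remSl0_wInf_add_two_pi hq α β ht
  have h1 := periodic_of_deriv h0 (fun t ht => hasDerivAt_remSl0_wInf_U hq hq0 (V_subset_U ht) α β)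
    (fun t ht => hasDerivAt_remSl0_wInf_U hq hq0 (V_add_two_pi_mem_U ht) α β)
  have h2 := periodic_of_deriv h1 (fun t ht => hasDerivAt_remSl1_wInf_U hq hq0 (V_subset_U ht) α β)
    (fun t ht => hasDerivAt_remSl1_wInf_U hq hq0 (V_add_two_pi_mem_U ht) α β)
  have h3 := periodic_of_deriv h2 (fun t ht => hasDerivAt_remSl2_wInf_U hq hq0 (V_subset_U ht) α β)
    (fun t ht => hasDerivAt_remSl2_wInf_U hq hq0 (V_add_two_pi_mem_U ht) α β)
  exact ⟨h0, h1, h2, h3⟩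

/-- [folklore] `−π ∈ V`. -/
theorem neg_pi_mem_V : -Real.pi ∈ Ioo (-Real.pi - delta166 (d + 1)) (-Real.pi + delta166 (d + 1)) := by
  have hδ := delta166_pos (d + 1); exact ⟨by linarith, by linarith⟩

include hq hq0 in
/-- [our object] **THE PERIODIC ENDPOINT VALUES** (the `hper` rows of `PuncturedCoordDerivMajorant`): `remSl_k (−π) = remSl_k π`, `k ≤ 3`. -/
theorem remSl_wInf_endpoints (α β : Fin (d + 1)) :
    remSl0 (wInf (d := d)) s i α β (-Real.pi) = remSl0 (wInf (d := d)) s i α β Real.pi ∧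
      remSl1 (wInf (d := d)) s i α β (-Real.pi) = remSl1 (wInf (d := d)) s i α β Real.pi ∧
      remSl2 (wInf (d := d)) s i α β (-Real.pi) = remSl2 (wInf (d := d)) s i α β Real.pi ∧
      remSl3 (wInf (d := d)) s i α β (-Real.pi) = remSl3 (wInf (d := d)) s i α β Real.pi := by
  obtain ⟨h0, h1, h2, h3⟩ := remSl_wInf_add_two_pi hq hq0 α β
  have e : -Real.pi + 2 * Real.pi = Real.pi := by ring
  refine ⟨?_, ?_, ?_, ?_⟩
  · rw [← h0 _ neg_pi_mem_V, e]
  · rw [← h1 _ neg_pi_mem_V, e]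
  · rw [← h2 _ neg_pi_mem_V, e]
  · rw [← h3 _ neg_pi_mem_V, e]

end Endpoints

/-! ## §5 Measurability of the top slice -/

/-- [folklore] **THE TOP SLICE `remSl3` IS A.E.-STRONGLY MEASURABLE ON `[−π,π]`** — it is the derivative of `remSl2` there (Mathlib `measurable_deriv`). -/
theorem aestronglyMeasurable_remSl3_wInf {s : Fin (d + 1) → ℝ} {i : Fin (d + 1)} (hq : i.removeNth s ∈ BZ d) (hq0 : i.removeNth s ≠ 0)
    (α β : Fin (d + 1)) :
    AEStronglyMeasurable (remSl3 (wInf (d := d)) s i α β) (volume.restrict (Icc (-Real.pi) Real.pi)) := by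
  have hm : Measurable (deriv (remSl2 (wInf (d := d)) s i α β)) := measurable_deriv _
  refine (hm.aestronglyMeasurable).congr ?_
  filter_upwards [ae_restrict_mem measurableSet_Icc] with t ht
  exact (hasDerivAt_remSl2_wInf_U hq hq0 (Icc_subset_U ht) α β).deriv

/-! ## §6 The graded letters, unconditional -/

/-- [our object] THE LETTER CONSTANT OF THE ORDER-3 CHAIN AT `Re W_∞`: `Krem d := (d+1)·aSum ((d+1)(π²∕4)^{d+4}) ((d+1)KAP d) ((d+1)KAP d) ((d+1)KAP d) (π+1)·KRP d
· cSum (4∕π²) 2 2 2 (π+1)` (the `K·c` of `RemainderSymbolSlice.norm_remSl_le` at R2's constants; non-explicit through `bound166`∕`delta166`). -/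
def Krem (d : ℕ) : ℝ :=
  ((d : ℝ) + 1) * (aSum (((d : ℝ) + 1) * (Real.pi ^ 2 / 4) ^ (d + 1 + 3)) (((d : ℝ) + 1) * KAP d) (((d : ℝ) + 1) * KAP d)
      (((d : ℝ) + 1) * KAP d) (Real.pi + 1) * KRP d)
    * cSum (4 / Real.pi ^ 2) 2 2 2 (Real.pi + 1)

/-- [our object] **THE GRADED LETTERS OF THE REMAINDER SYMBOL AT `Re W_∞`, UNCONDITIONAL**: for `t ∈ [−π,π]`, `q = removeNth i s ∈ BZ d ∖ {0}`, `p := update s i t`: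
`‖remSl0 t‖ ≤ Krem d`, `‖remSl1 t‖ ≤ 3·Krem d∕‖p‖`, `‖remSl2 t‖ ≤ 9·Krem d∕‖p‖²`, `‖remSl3 t‖ ≤ 27·Krem d∕‖p‖³` — the proof of `RemainderSymbolSlice.norm_remSl_le`
with H2-P-REG R2 (`graded_perfect_feyn_entry` ∕ `graded_perfect_excess_entry`, LOCAL) in place of R1's global rows. -/
theorem norm_remSl_wInf_le_local {s : Fin (d + 1) → ℝ} {i : Fin (d + 1)} {t : ℝ}
    (ht : t ∈ Icc (-Real.pi) Real.pi) (hq : i.removeNth s ∈ BZ d) (hq0 : i.removeNth s ≠ 0) (α β : Fin (d + 1)) :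
    ‖remSl0 (wInf (d := d)) s i α β t‖ ≤ Krem d ∧
      ‖remSl1 (wInf (d := d)) s i α β t‖ ≤ 3 * Krem d / ‖Function.update s i t‖ ∧
      ‖remSl2 (wInf (d := d)) s i α β t‖ ≤ 9 * Krem d / ‖Function.update s i t‖ ^ 2 ∧
      ‖remSl3 (wInf (d := d)) s i α β t‖ ≤ 27 * Krem d / ‖Function.update s i t‖ ^ 3 := by
  obtain ⟨hmem, hne, hpos, hle⟩ := slicePt_facts ht hq hq0 (s := s) (i := i)
  set p := Function.update s i t with hp_def
  set M : ℝ := Real.pi + 1 with hM_def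
  set Cf : ℝ := KAP d with hCf_def
  set Cx : ℝ := KRP d with hCx_def
  set cinv : ℝ := (Real.pi ^ 2 / 4) ^ (d + 1 + 3) with hcinv_def
  have hn : (Fintype.card (Fin (d + 1)) : ℝ) = (d : ℝ) + 1 := by rw [Fintype.card_fin]; push_cast; ring
  have hM1 : (1 : ℝ) ≤ M := by rw [hM_def]; linarith [Real.pi_gt_three]
  have hpM : ‖p‖ ≤ M := hle.trans (by rw [hM_def]; linarith)
  have hpi : p i = t := by simp [hp_def]
  -- R2's letters at base point `p`, read on the curves based at `s`
  have hfeyn : ∀ k ≤ 3, ∀ γ β, ‖feynSl (wInf (d := d)) s i k t γ β‖ ≤ Cf * ‖p‖ ^ (2 - k) := by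
    intro k hk γ β
    have h := graded_perfect_feyn_entry hmem i γ β k hk
    have e : iteratedDeriv k (fun u : ℝ => feynMat (fun μ ν => (W166Inf μ ν (ofRealVec (Function.update p i u))).re)
        (d1Sym (Function.update p i u)) γ β) (p i) = feynSl (wInf (d := d)) s i k t γ β := by
      rw [← feynSl_update (wInf (d := d)) s i t, hpi]; rfl
    rw [e] at h; exact h
  have hexc : ∀ k ≤ 3, ∀ γ β, ‖excSl (wInf (d := d)) s i k t γ β‖ ≤ Cx * ‖p‖ ^ (4 - k) := by
    intro k hk γ β
    have h := graded_perfect_excess_entry hmem i γ β k hk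
    have e : iteratedDeriv k (fun u : ℝ => maxwellMat (fun μ ν => (W166Inf μ ν (ofRealVec (Function.update p i u))).re - 1)
        (d1Sym (Function.update p i u)) γ β) (p i) = excSl (wInf (d := d)) s i k t γ β := by
      rw [← excSl_update (wInf (d := d)) s i t, hpi]; rfl
    rw [e] at h; exact h
  -- op-norm letters for the `InverseSymbolDeriv` chain
  have hCf0 : 0 ≤ Cf := le_trans (norm_nonneg _) ((hfeyn 2 (by norm_num) α α).trans (by norm_num))
  have hinv := hinv_wInf (d := d) p hmem hne
  have hcinv0 : 0 ≤ cinv := by positivity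
  have l0 : ‖(feynSl (wInf (d := d)) s i 0 t)⁻¹‖ ≤ (Fintype.card (Fin (d + 1)) : ℝ) * cinv / ‖p‖ ^ 2 := by
    rw [feynSl_zero, mul_div_assoc]
    exact norm_le_card_mul _ (by positivity) hinv
  have l1 : ‖feynSl (wInf (d := d)) s i 1 t‖ ≤ (Fintype.card (Fin (d + 1)) : ℝ) * Cf * ‖p‖ := by
    have h := norm_le_card_mul _ (by positivity : (0:ℝ) ≤ Cf * ‖p‖ ^ (2 - 1)) (hfeyn 1 (by norm_num))
    calc ‖feynSl (wInf (d := d)) s i 1 t‖ ≤ (Fintype.card (Fin (d + 1)) : ℝ) * (Cf * ‖p‖ ^ (2 - 1)) := h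
      _ = (Fintype.card (Fin (d + 1)) : ℝ) * Cf * ‖p‖ := by norm_num; ring
  have l2 : ‖feynSl (wInf (d := d)) s i 2 t‖ ≤ (Fintype.card (Fin (d + 1)) : ℝ) * Cf := by
    have h := norm_le_card_mul _ (by positivity : (0:ℝ) ≤ Cf * ‖p‖ ^ (2 - 2)) (hfeyn 2 (by norm_num))
    calc ‖feynSl (wInf (d := d)) s i 2 t‖ ≤ (Fintype.card (Fin (d + 1)) : ℝ) * (Cf * ‖p‖ ^ (2 - 2)) := h
      _ = (Fintype.card (Fin (d + 1)) : ℝ) * Cf := by norm_num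
  have l3 : ‖feynSl (wInf (d := d)) s i 3 t‖ ≤ (Fintype.card (Fin (d + 1)) : ℝ) * Cf := by
    have h := norm_le_card_mul _ (by positivity : (0:ℝ) ≤ Cf * ‖p‖ ^ (2 - 3)) (hfeyn 3 le_rfl)
    calc ‖feynSl (wInf (d := d)) s i 3 t‖ ≤ (Fintype.card (Fin (d + 1)) : ℝ) * (Cf * ‖p‖ ^ (2 - 3)) := h
      _ = (Fintype.card (Fin (d + 1)) : ℝ) * Cf := by norm_num
  -- entry letters for the excess chain
  have m0 : ∀ γ β, ‖excSl (wInf (d := d)) s i 0 t γ β‖ ≤ Cx * ‖p‖ ^ 4 := fun γ β => by simpa using hexc 0 (by norm_num) γ β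
  have m1 : ∀ γ β, ‖excSl (wInf (d := d)) s i 1 t γ β‖ ≤ Cx * ‖p‖ ^ 3 := fun γ β => by simpa using hexc 1 (by norm_num) γ β
  have m2 : ∀ γ β, ‖excSl (wInf (d := d)) s i 2 t γ β‖ ≤ Cx * ‖p‖ ^ 2 := fun γ β => by simpa using hexc 2 (by norm_num) γ β
  have m3 : ∀ γ β, ‖excSl (wInf (d := d)) s i 3 t γ β‖ ≤ Cx * ‖p‖ := fun γ β => by simpa using hexc 3 le_rfl γ β
  -- scalar letters
  have e := update_eq_insertNth s i t
  have pf : 4 / Real.pi ^ 2 * ‖p‖ ^ 2 ≤ |fD (i.removeNth s) i t| := by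
    rw [abs_of_pos (fD_pos hq hq0 i t), hp_def, e]; exact norm_sq_le_fD i ht hq
  have pf1 : |fD1 t| ≤ 2 * ‖p‖ := by rw [hp_def, e]; exact abs_fD1_le i t _
  have pf2 : |fD2 t| ≤ 2 := abs_fD2_le t
  have pf3 : |fD3 t| ≤ 2 := abs_fD3_le t
  have hκ : (0 : ℝ) < 4 / Real.pi ^ 2 := by positivity
  -- assemble
  have h := norm_bSl_le (A₀ := feynSl (wInf (d := d)) s i 0) (A₁ := feynSl (wInf (d := d)) s i 1) (A₂ := feynSl (wInf (d := d)) s i 2)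
    (A₃ := feynSl (wInf (d := d)) s i 3)
    (M₀ := excSl (wInf (d := d)) s i 0) (M₁ := excSl (wInf (d := d)) s i 1) (M₂ := excSl (wInf (d := d)) s i 2)
    (M₃ := excSl (wInf (d := d)) s i 3)
    (f := fD (i.removeNth s) i) (f₁ := fD1) (f₂ := fD2) (f₃ := fD3)
    hpos hpM hκ l0 l1 l2 l3 m0 m1 m2 m3 pf pf1 pf2 pf3 α β
  have hK : ((Fintype.card (Fin (d + 1)) : ℝ) * (aSum ((Fintype.card (Fin (d + 1)) : ℝ) * cinv) ((Fintype.card (Fin (d + 1)) : ℝ) * Cf)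
      ((Fintype.card (Fin (d + 1)) : ℝ) * Cf) ((Fintype.card (Fin (d + 1)) : ℝ) * Cf) M * Cx)) * cSum (4 / Real.pi ^ 2) 2 2 2 M = Krem d := by
    rw [hn]; rfl
  rw [hK] at h
  unfold remSl0 remSl1 remSl2 remSl3
  exact h

end Summit.QuantumFields.BalabanUV.Beta.FP.PerfectRemainderSliceLocal

end
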